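import Mathlib
import Literature.AlgebraicGeometry.Resolution.BranchContactOrder
import HarnessLib

/-!
# The contact order along branches: invariance under field isomorphisms

Topic: `Literature/AlgebraicGeometry/Resolution`. Sequel of `BranchContactOrder.lean`: the branch
set, the contact lengths `ℓ_W(W/JW)` and the contact order `contactOrder D J` of a subring
`D ⊆ K` and a subset `J ⊆ K` are invariant under isomorphisms of the ambient field
(`contactOrder_map_ringEquiv`), so that the contact order of the image of one branch along
another is an invariant of the (abstract) one-dimensional local ring — used to transport Krull's
blow-up tower invariant along ring isomorphisms (Kollár 2007, Thm. 1.101). All PROVED.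

## Sources

* J. Kollár, *Lectures on Resolution of Singularities*, Ann. of Math. Stud. 166 (2007), §1.4,
  Thm. 1.101. [Kollar2007]
-/

noncomputable section

open IsLocalRing IsDedekindDomain

namespace Literature.AlgebraicGeometry.Resolution

universe u

variable {K : Type u} [Field K]

/-! ## Invariance under isomorphisms of the ambient field -/

section Transport

/-- The length of `A/I` as an `A`-module is invariant under ring isomorphisms. [folklore] -/
private theorem length_quotient_eq_of_ringEquiv {A B : Type u} [CommRing A] [CommRing B]
    (f : A ≃+* B) (I : Ideal A) :
    Module.length A (A ⧸ I) = Module.length B (B ⧸ I.map (f : A →+* B)) := by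
  have hA : Module.length A (A ⧸ I) = Module.length (A ⧸ I) (A ⧸ I) :=
    Module.length_eq_of_surjective (Ideal.Quotient.mk_surjective)
  have hB : Module.length B (B ⧸ I.map (f : A →+* B)) =
      Module.length (B ⧸ I.map (f : A →+* B)) (B ⧸ I.map (f : A →+* B)) :=
    Module.length_eq_of_surjective (Ideal.Quotient.mk_surjective)
  rw [hA, hB]
  let g : A ⧸ I ≃+* B ⧸ I.map (f : A →+* B) := Ideal.quotientEquiv I _ f rfl
  haveI := RingHomInvPair.of_ringEquiv g
  haveI := RingHomInvPair.of_ringEquiv_symm g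
  let g' : (A ⧸ I) ≃ₛₗ[(g : A ⧸ I →+* B ⧸ I.map (f : A →+* B))] (B ⧸ I.map (f : A →+* B)) :=
    { g with map_smul' := fun a b => by simp [smul_eq_mul, map_mul] }
  apply WithBot.coe_injective
  rw [Module.coe_length, Module.coe_length, Order.krullDim_eq_of_orderIso (Submodule.orderIsoMapComap g')]

variable {K' : Type u} [Field K']

/-- The image of a valuation subring under a field isomorphism. [folklore] -/
private theorem mem_comap_symm_iff (e : K ≃+* K') (W : ValuationSubring K) (x : K) :
    e x ∈ W.comap (e.symm : K' →+* K) ↔ x ∈ W := by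
  rw [ValuationSubring.mem_comap]
  change e.symm (e x) ∈ W ↔ x ∈ W
  rw [e.symm_apply_apply]

/-- Field isomorphisms carry branches to branches. [cite: Kollar2007, §1.4] -/
theorem comap_symm_mem_branchValuationSet_iff (e : K ≃+* K') (D : Subring K) (W : ValuationSubring K) :
    W.comap (e.symm : K' →+* K) ∈ branchValuationSet (D.map (e : K →+* K')) ↔ W ∈ branchValuationSet D := by
  constructor
  · rintro ⟨htop, hle⟩
    refine ⟨fun h => htop ?_, fun x hx => ?_⟩
    · refine eq_top_iff.mpr fun y _ => ?_
      rw [ValuationSubring.mem_comap, h]; trivial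
    · have : e x ∈ W.comap (e.symm : K' →+* K) := hle ⟨x, hx, rfl⟩
      exact (mem_comap_symm_iff e W x).mp this
  · rintro ⟨htop, hle⟩
    refine ⟨fun h => htop ?_, ?_⟩
    · refine eq_top_iff.mpr fun x _ => ?_
      have : e x ∈ W.comap (e.symm : K' →+* K) := h ▸ trivial
      exact (mem_comap_symm_iff e W x).mp this
    · rintro _ ⟨x, hx, rfl⟩
      exact (mem_comap_symm_iff e W x).mpr (hle hx)

/-- The contact length is invariant under field isomorphisms. [cite: Kollar2007, §1.4] -/
theorem branchLength_comap_symm (e : K ≃+* K') (W : ValuationSubring K) (J : Set K) :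
    branchLength (W.comap (e.symm : K' →+* K)) (e '' J) = branchLength W J := by
  -- the ring isomorphism `W ≃ e(W)`
  let W' := W.comap (e.symm : K' →+* K)
  let f : W ≃+* W' :=
    { toFun := fun w => ⟨e w, (mem_comap_symm_iff e W w).mpr w.2⟩
      invFun := fun w' => ⟨e.symm w', ValuationSubring.mem_comap.mp w'.2⟩
      left_inv := fun w => Subtype.ext (e.symm_apply_apply _)
      right_inv := fun w' => Subtype.ext (e.apply_symm_apply _)
      map_mul' := fun a b => Subtype.ext (map_mul e _ _)
      map_add' := fun a b => Subtype.ext (map_add e _ _) }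
  have hmap : (branchIdeal W J).map (f : W →+* W') = branchIdeal W' (e '' J) := by
    apply le_antisymm
    · rw [Ideal.map_le_iff_le_comap]
      refine Ideal.span_le.mpr fun w hw => ?_
      exact Ideal.subset_span (show ((f w : W') : K') ∈ e '' J from ⟨w, hw, rfl⟩)
    · refine Ideal.span_le.mpr ?_
      rintro w' ⟨x, hx, hxw⟩
      have hxW : x ∈ W := by
        have h2 : (e.symm : K' →+* K) (w' : K') ∈ W := ValuationSubring.mem_comap.mp w'.2
        rw [← hxw] at h2
        change e.symm (e x) ∈ W at h2
        rwa [e.symm_apply_apply] at h2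
      have hw' : w' = f ⟨x, hxW⟩ := Subtype.ext hxw.symm
      rw [hw']
      exact Ideal.mem_map_of_mem _ (mem_branchIdeal hx)
  rw [branchLength, branchLength, ← hmap]
  exact (length_quotient_eq_of_ringEquiv f _).symm

/-- **The contact order is invariant under field isomorphisms**:
`contactOrder (e D) (e J) = contactOrder D J`. [cite: Kollar2007, §1.4] -/
theorem contactOrder_map_ringEquiv (e : K ≃+* K') (D : Subring K) (J : Set K) :
    contactOrder (D.map (e : K →+* K')) (e '' J) = contactOrder D J := by
  -- the bijection of branch sets
  let σ : branchValuationSet D ≃ branchValuationSet (D.map (e : K →+* K')) :=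
    { toFun := fun W => ⟨W.1.comap (e.symm : K' →+* K), (comap_symm_mem_branchValuationSet_iff e D W.1).mpr W.2⟩
      invFun := fun W' => ⟨W'.1.comap (e : K →+* K'), by
        have h := (comap_symm_mem_branchValuationSet_iff e D (W'.1.comap (e : K →+* K'))).mp
        apply h
        convert W'.2 using 1
        ext x
        rw [ValuationSubring.mem_comap, ValuationSubring.mem_comap]
        change e (e.symm x) ∈ W'.1 ↔ x ∈ W'.1
        rw [e.apply_symm_apply]⟩
      left_inv := fun W => Subtype.ext (by
        ext x
        rw [ValuationSubring.mem_comap, ValuationSubring.mem_comap]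
        change e.symm (e x) ∈ W.1 ↔ x ∈ W.1
        rw [e.symm_apply_apply])
      right_inv := fun W' => Subtype.ext (by
        ext x
        rw [ValuationSubring.mem_comap, ValuationSubring.mem_comap]
        change e (e.symm x) ∈ W'.1 ↔ x ∈ W'.1
        rw [e.apply_symm_apply]) }
  rw [contactOrder, contactOrder,
    ← Equiv.iSup_comp (g := fun W' : branchValuationSet (D.map (e : K →+* K')) => branchLength W'.1 (e '' J)) σ]
  exact iSup_congr fun W => branchLength_comap_symm e W.1 J

end Transport

end Literature.AlgebraicGeometry.Resolution
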